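import Literature.AlgebraicGeometry.Motives.HypersurfaceLinearSections
import Literature.AlgebraicGeometry.Motives.CartierDivisorGysinProjective
import Literature.AlgebraicGeometry.Motives.ProjectiveSpaceLinearSubspaceDegree
import Literature.RingTheory.MvPolynomial.CubicFormPlaneChains
import HarnessLib

/-!
# The Gysin map of a hypersurface `X = V₊(F) ⊆ ℙ^{d+1}` on a cycle of `ℙ^{d+1}` is a multiple of `H_X^c ∩ [X]`

R. Mboro, *Remarks on the `CH₂` of cubic hypersurfaces* (Geom. Dedicata 200 (2018) =
arXiv:1701.04488), proof of Thm. 1.2 (p. 7): "Remembering that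
`d H_X · f_*(1) = i_X^* i_{X,*} f_*(1) ∈ ℤ · H_X^{n-r}`, we are done" — for a hypersurface
`i_X : X ↪ ℙⁿ⁺¹` the composite `i_X^* i_{X,*}` factors through `CH_{r+1}(ℙⁿ⁺¹) = ℤ`, and `i_X^*`
of the generator (an `(r+1)`-plane `Λ`) is the class of the linear section `[X ∩ Λ] = H_X^{n-r}`;
the same fact is used again in the proof of Thm. 1.3 (p. 8) and is the reason every cycle swept
out on `X` by a family of lines of `ℙⁿ⁺¹` meeting `X` properly is a multiple of `H_X^{n-r}`
(Thm. 1.2, Case 2: "`(f_* ℙ_Σ̃)|_X = d Σ + R`").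

This file proves that step on the tree's carriers, for a hypersurface `i : X ≅ V₊(F) ⊆ ℙ^{d+1}_K`
(`X` integral, `i` a closed immersion with image the zero locus of a prime form `F` of degree
`e ≥ 1`) and the Gysin cycle `V₊(F) · γ|_X` (`CartierDivisor.gysinCycle`, Fulton Def. 2.4.1 / §2.6,
`Motives/CartierDivisorGysin`) of a `(m+1)`-cycle `γ` of `ℙ^{d+1}`, `m + c = d`:

* `ProjSpace.gysin_hypotheses_formDivisor` — the two hypotheses of
  `CartierDivisor.gysinCycle_mem_ratTrivial` for `D = V₊(F)` on `ℙᴺ` itself (from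
  `Motives/CartierDivisorGysinProjective`); `ProjSpace.setOf_not_avoids_formDivisor` —
  `|V₊(F)| = V₊(F)`;
* `ProjSpace.exists_isRationallyEquivalent_zsmul_primeCycle_of_toIdeal_eq_span` — **every
  `(N-t)`-cycle of `ℙᴺ_K` is rationally equivalent to an integer multiple of ANY `(N-t)`-plane
  `V₊(L₁, …, L_t)`** (`K` algebraically closed): `CH_j(ℙᴺ) = ℤ · [Λ_j]`
  (`Motives/ChowProjectiveSpaceLines`) and any two `j`-planes have the same class
  (`IsLinearSubspacePoint.ofPoint_eq_ofPoint_of_id`, `Motives/ProjectiveSpaceLinearSubspaceDegree`);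
* `ProjSpace.exists_linearForms_not_mem_idealSpan` — for a nonzero form `F` of positive degree and
  `c ≤ N` (`K` infinite) there are `c` independent linear forms `ℓ_k` with `F ∉ (ℓ₁, …, ℓ_c)`
  (an `(N-c)`-plane not contained in `V₊(F)`: the first `c` coordinate forms of a point where `F`
  does not vanish, `Literature.RingTheory.MvPolynomial.exists_linearForms_forall_mem_ideal_span_vanishing`);
* `Hypersurface.gysinCycle_formDivisor_mem_ratTrivial` — **`V₊(F) · α|_X ∈ Rat_m(X)` for
  `α ∈ Rat_{m+1}(ℙ^{d+1})`** (Fulton Cor. 2.4.1 for `D = V₊(F)`, `|D| = i(X)`);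
* `Hypersurface.gysinCycle_formDivisor_primeCycle_eq_iterInter` — for an `(m+1)`-plane
  `M = V₊(ℓ₁, …, ℓ_c) ⊄ X`, `V₊(F) · [M]|_X` is the iterated section cycle
  `(i^*V₊(ℓ_c)) · (⋯ ((i^*V₊(ℓ₁)) · [X]))` of `Motives/HypersurfaceLinearSections`
  (`map_iterInter_primeCycle_eq_primeInter` and `restrict ∘ i_* = id`);
* `Hypersurface.exists_isRationallyEquivalent_gysinCycle_zsmul_iterInter` — **for every
  `(m+1)`-cycle `γ` of `ℙ^{d+1}` there is `a ∈ ℤ` with `V₊(F) · γ|_X ∼_rat a · [X ∩ M]` on `X`**;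
  `Hypersurface.exists_mk_gysinCycle_eq_zsmul_hyperplaneSectionOnIter` — in `CH_m(X)`:
  **`[V₊(F) · γ|_X] = a · (c₁(𝒪_X(1))ᶜ ∩ [X])`**, i.e. `i^* γ ∈ ℤ · H_X^c` (Mboro p. 7).

Everything is proved; no named facts.

## References

* [Mboro2018] R. Mboro, Remarks on the CH₂ of cubic hypersurfaces, Geom. Dedicata 200 (2018) =
  arXiv:1701.04488, proof of Thm. 1.2 (p. 7: "`d H_X · f_*(1) = i_X^* i_{X,*} f_*(1) ∈ ℤ · H_X^{n-r}`")
  and of Thm. 1.3 (p. 8).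
* [Fulton1998] W. Fulton, Intersection Theory, 2nd ed. (1998), Def. 2.4.1, Cor. 2.4.1, §2.6,
  Example 1.9.3, Example 2.5.1.
-/

noncomputable section

open CategoryTheory AlgebraicGeometry Order Topology TopologicalSpace
open Literature.AlgebraicGeometry.Motives.Segre Literature.AlgebraicGeometry.Motives.RatFn

universe u

namespace Literature.AlgebraicGeometry.Motives

attribute [local instance] MvPolynomial.gradedAlgebra

/-! ### `D = V₊(F)` on `ℙᴺ`: the Gysin hypotheses, the support, the generator -/

namespace ProjSpace

variable {N : ℕ} {K : Type u} [Field K]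

/-- **The two hypotheses of `CartierDivisor.gysinCycle_mem_ratTrivial` hold for `D = V₊(F)` on
`ℙᴺ`**: every closed subvariety `V ⊆ ℙᴺ` carries an effective representative of the class of
`V₊(F)|_V`, and every `r ∈ R(V)ˣ` has `div(r) = D₁ - D₂` with `D₁, D₂` effective
(`Motives/CartierDivisorGysinProjective`, along `V ↪ ℙᴺ`). [cite: Fulton1998, Cor. 2.4.1 and Def. 2.4.1 (p. 38)] -/
theorem gysin_hypotheses_formDivisor {e : ℕ} (he : 0 < e) {F : MvPolynomial (Fin (N + 1)) K}
    (hF : F ∈ grading (Fin (N + 1)) K e) (hF0 : F ≠ 0) :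
    (∀ V : ClosedSubvariety (P N K), ¬ (formDivisor F hF hF0).Avoids V.genericPoint →
        ∃ P' : CartierDivisor V.carrier, P'.IsEffective ∧
          P'.LinEquiv ((formDivisor F hF hF0).classPullback V.ι)) ∧
    (∀ (V : ClosedSubvariety (P N K)) (r : V.carrier.functionField) (hr : r ≠ 0),
      ∃ D₁ D₂ : CartierDivisor V.carrier, D₁.IsEffective ∧ D₂.IsEffective ∧
        (CartierDivisor.principal r hr).SameDivisor (D₁.sub D₂)) :=
  ⟨fun V _ => exists_isEffective_linEquiv_classPullback_formDivisor V.ι he hF hF0,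
    fun V _ hr => exists_isEffective_sameDivisor_sub V.ι hr⟩

/-- **`|V₊(F)| = V₊(F)`**: the divisor `V₊(F)` fails to avoid `x` iff `F ∈ 𝔭_x`. [folklore] -/
theorem setOf_not_avoids_formDivisor {e : ℕ} (he : 0 < e) {F : MvPolynomial (Fin (N + 1)) K}
    (hF : F ∈ grading (Fin (N + 1)) K e) (hF0 : F ≠ 0) :
    {x : P N K | ¬ (formDivisor F hF hF0).Avoids x} =
      ProjectiveSpectrum.zeroLocus (MvPolynomial.homogeneousSubmodule (Fin (N + 1)) K) {F} := by
  ext x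
  rw [Set.mem_setOf_eq, formDivisor_avoids_iff hF hF0 he, not_not]
  have key := ProjectiveSpectrum.mem_zeroLocus (𝒜 := grading (Fin (N + 1)) K) x {F}
  rw [Set.singleton_subset_iff, SetLike.mem_coe] at key
  exact key.symm

/-- **Every `(N - t)`-cycle of `ℙᴺ_K` is rationally equivalent to an integer multiple of any given
`(N - t)`-plane** `V₊(L₁, …, L_t)` (`K` algebraically closed; `L_j` independent linear forms,
`t ≤ N`, `w` the generic point of the plane): `CH_j(ℙᴺ) = ℤ · [Λ_j]` for the coordinate `j`-plane
(Fulton Example 1.9.3, `Motives/ChowProjectiveSpaceLines`) and any two `j`-planes have the same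
class (`Motives/ProjectiveSpaceLinearSubspaceDegree`). [cite: Fulton1998, Example 1.9.3 (p. 23)] -/
theorem exists_isRationallyEquivalent_zsmul_primeCycle_of_toIdeal_eq_span [IsAlgClosed K] {t : ℕ}
    (L : Fin t → MvPolynomial (Fin (N + 1)) K) (hL : LinearIndependent K L)
    (hhom : ∀ j, (L j).IsHomogeneous 1) (ht : t ≤ N) {w : ↥(projectiveSpace N K).left}
    (hw : (ProjectiveSpectrum.asHomogeneousIdeal
      (𝒜 := MvPolynomial.homogeneousSubmodule (Fin (N + 1)) K) w).toIdeal = Ideal.span (Set.range L))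
    (γ : AlgebraicCycle (projectiveSpace N K).left ℤ)
    (hγ : γ ∈ cyclesOfDim (projectiveSpace N K).left (N - t)) :
    ∃ a : ℤ, IsRationallyEquivalent γ (a • primeCycle w) (N - t) := by
  set p : ↥(projectiveSpace N K).left := ProjectiveSpaceCells.coordGenericPoint K (n := N) (N - t)
    with hp
  obtain ⟨a, ha⟩ := ProjectiveSpaceCells.exists_isRationallyEquivalent_zsmul_coordGenericPoint K
    (n := N) (j := N - t) (Nat.sub_le N t) γ hγ
  have hcoord := ProjectiveSpaceCells.isLinearSubspacePoint_coordGenericPoint K (n := N)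
    (j := N - t) (Nat.sub_le N t)
  have hwlin : IsLinearSubspacePoint (N - t) N (𝟙 (projectiveSpace N K)) w :=
    isLinearSubspacePoint_of_toIdeal_eq_span L hL hhom ht hw
  have heq := hcoord.ofPoint_eq_ofPoint_of_id hwlin
  have hrat : primeCycle p - primeCycle w ∈ ratTrivial (projectiveSpace N K).left (N - t) :=
    ChowGroup.mk_eq_mk_iff.mp heq
  have ha' : γ - a • primeCycle p ∈ ratTrivial (projectiveSpace N K).left (N - t) := ha
  refine ⟨a, ?_⟩
  have hsum : γ - a • primeCycle w = (γ - a • primeCycle p) + a • (primeCycle p - primeCycle w) := by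
    rw [smul_sub]; abel
  change γ - a • primeCycle w ∈ _
  rw [hsum]
  exact add_mem ha' (AddSubgroup.zsmul_mem _ hrat a)

/-- **An `(N - c)`-plane not contained in `V₊(F)`**: for a nonzero form `F` of positive degree over
an infinite field and `c ≤ N`, there are `c` linearly independent linear forms `ℓ₁, …, ℓ_c` with
`F ∉ (ℓ₁, …, ℓ_c)` (take a vector `x` with `F(x) ≠ 0` and `c` of the `N` independent linear forms
cutting out the point `[x]`: they all vanish at `x`). [folklore] -/
theorem exists_linearForms_not_mem_idealSpan [Infinite K] {e : ℕ} (he : 0 < e)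
    {F : MvPolynomial (Fin (N + 1)) K} (hF : F.IsHomogeneous e) (hF0 : F ≠ 0) {c : ℕ} (hc : c ≤ N) :
    ∃ ℓ : Fin c → MvPolynomial (Fin (N + 1)) K, LinearIndependent K ℓ ∧
      (∀ k, (ℓ k).IsHomogeneous 1) ∧ F ∉ Ideal.span (Set.range ℓ) := by
  classical
  -- a vector where `F` does not vanish
  obtain ⟨x, hx⟩ : ∃ x : Fin (N + 1) → K, MvPolynomial.eval x F ≠ 0 := by
    by_contra h
    simp only [not_exists, not_not] at h
    exact hF0 (MvPolynomial.funext fun x => by rw [h x, map_zero])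
  have hx0 : x ≠ 0 := by
    rintro rfl
    apply hx
    have h0 : MvPolynomial.constantCoeff F = 0 := by
      rw [congrFun MvPolynomial.constantCoeff_eq F]
      exact hF.coeff_eq_zero (by simp; omega)
    rw [MvPolynomial.eval_zero]
    exact h0
  have hw : LinearIndependent K ![x] := by
    rw [linearIndependent_unique_iff]
    exact hx0
  obtain ⟨t, L, htu, hLlin, hLhom, hLvan, -⟩ :=
    Literature.RingTheory.MvPolynomial.exists_linearForms_forall_mem_ideal_span_vanishing hw
  have htc : c ≤ t := by omega
  refine ⟨fun k => L (Fin.castLE htc k), hLlin.comp _ (Fin.castLE_injective htc),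
    fun k => hLhom _, fun hmem => hx ?_⟩
  -- every element of the ideal vanishes at `x`
  have hxspan : x ∈ Submodule.span K (Set.range ![x]) :=
    Submodule.subset_span ⟨0, by simp⟩
  have key : ∀ G ∈ Ideal.span (Set.range fun k => L (Fin.castLE htc k)), MvPolynomial.eval x G = 0 := by
    intro G hG
    refine Submodule.span_induction (p := fun G _ => MvPolynomial.eval x G = 0) ?_ ?_ ?_ ?_ hG
    · rintro _ ⟨k, rfl⟩
      exact hLvan _ x hxspan
    · exact map_zero _
    · intro a b _ _ ha hb
      rw [map_add, ha, hb, add_zero]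
    · intro a b _ hb
      rw [smul_eq_mul, map_mul, hb, mul_zero]
  exact key F hmem

end ProjSpace

/-! ### The Gysin map of the hypersurface on cycles of `ℙ^{d+1}` -/

namespace Hypersurface

open ProjSpace

variable {K : Type u} [Field K] {d e : ℕ} {X : SchemeOver K} [IsIntegral X.left]
  [LocallyOfFiniteType X.hom] (i : X ⟶ projectiveSpace (d + 1) K) [IsClosedImmersion i.left]
  {F : MvPolynomial (Fin (d + 1 + 1)) K} (hF : F ∈ grading (Fin (d + 1 + 1)) K e) (hprime : Prime F)
  (hrange : Set.range i.left.base =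
    ProjectiveSpectrum.zeroLocus (MvPolynomial.homogeneousSubmodule (Fin (d + 1 + 1)) K) {F})

include hF hprime hrange

omit [IsIntegral X.left] [LocallyOfFiniteType X.hom] [IsClosedImmersion i.left] in
/-- **`i(X) = |V₊(F)|`**: the image of the hypersurface is the support of the divisor `V₊(F)`.
[folklore] -/
theorem range_base_eq_setOf_not_avoids :
    Set.range i.left.base = {x | ¬ (formDivisor F hF hprime.ne_zero).Avoids x} := by
  rw [hrange, setOf_not_avoids_formDivisor (pos_of_mem_grading_of_prime hF hprime) hF hprime.ne_zero]

omit [IsIntegral X.left] [LocallyOfFiniteType X.hom] in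
/-- **Fulton, Cor. 2.4.1 for `D = V₊(F)`, `|D| = i(X)`: `V₊(F) · α|_X ∈ Rat_m(X)` for
`α ∈ Rat_{m+1}(ℙ^{d+1})`** — intersecting with the hypersurface passes to rational equivalence
(the map `i_X^* : CH_{m+1}(ℙ^{d+1}) → CH_m(X)` of Mboro, arXiv:1701.04488, p. 7, is well defined).
[cite: Fulton1998, Cor. 2.4.1 (p. 38)] [cite: Mboro2018, proof of Thm. 1.2 (arXiv:1701.04488, p. 7)] -/
theorem gysinCycle_formDivisor_mem_ratTrivial {m : ℕ}
    {α : AlgebraicCycle (projectiveSpace (d + 1) K).left ℤ}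
    (hα : α ∈ ratTrivial (projectiveSpace (d + 1) K).left (m + 1)) :
    CartierDivisor.gysinCycle (X := projectiveSpace (d + 1) K) i.left
        (formDivisor F hF hprime.ne_zero) α ∈ ratTrivial X.left m := by
  have he := pos_of_mem_grading_of_prime hF hprime
  obtain ⟨hrep, hdiff⟩ := gysin_hypotheses_formDivisor (N := d + 1) he hF hprime.ne_zero
  exact CartierDivisor.gysinCycle_mem_ratTrivial (X := projectiveSpace (d + 1) K) i.left
    (isEffective_formDivisor hF hprime.ne_zero) (range_base_eq_setOf_not_avoids i hF hprime hrange)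
    hrep hdiff hα

/-- **`V₊(F) · [M]|_X = (i^*V₊(ℓ_c)) · (⋯ ((i^*V₊(ℓ₁)) · [X]))` for an `(m+1)`-plane
`M = V₊(ℓ₁, …, ℓ_c) ⊄ X`**: the Gysin cycle of the prime cycle of the plane is the iterated linear
section cycle of `Motives/HypersurfaceLinearSections` (`map_iterInter_primeCycle_eq_primeInter`:
both push forward to `V₊(F) · [M]` on `ℙ^{d+1}`, and `restrict ∘ i_* = id`).
[cite: Fulton1998, Example 2.5.1 and Cor. 2.4.2 (pp. 38–41)] [cite: Mboro2018, proof of Prop. 1.4 (arXiv:1701.04488, p. 8)] -/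
theorem gysinCycle_formDivisor_primeCycle_eq_iterInter (c : ℕ)
    (ℓ : Fin c → MvPolynomial (Fin (d + 1 + 1)) K) (hℓ : ∀ k, ℓ k ∈ grading (Fin (d + 1 + 1)) K 1)
    (hlin : LinearIndependent K ℓ) (hc : c ≤ d + 1)
    (hav : ∀ k, (formDivisor (ℓ k) (hℓ k) (hlin.ne_zero k)).Avoids (i.left.base (genericPoint ↥X.left)))
    (w : ↥(projectiveSpace (d + 1) K).left)
    (hw : (ProjectiveSpectrum.asHomogeneousIdeal
      (𝒜 := MvPolynomial.homogeneousSubmodule (Fin (d + 1 + 1)) K) w).toIdeal =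
        Ideal.span (Set.range ℓ))
    (hFw : F ∉ ProjectiveSpectrum.asHomogeneousIdeal
      (𝒜 := MvPolynomial.homogeneousSubmodule (Fin (d + 1 + 1)) K) w) :
    CartierDivisor.gysinCycle (X := projectiveSpace (d + 1) K) i.left
        (formDivisor F hF hprime.ne_zero) (primeCycle w) =
      CartierDivisor.iterInter c
        (fun k => (formDivisor (ℓ k) (hℓ k) (hlin.ne_zero k)).pullbackAvoiding i.left (hav k))
        (primeCycle (genericPoint ↥X.left)) := by
  rw [CartierDivisor.gysinCycle, CartierDivisor.interCycle_primeCycle,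
    ← map_iterInter_primeCycle_eq_primeInter i hF hprime hrange c ℓ hℓ hlin hc hav w hw hFw,
    cycleRestrictClosed_map]

/-- **`V₊(F) · γ|_X ∼_rat a · [X ∩ M]` on `X`** (Mboro, arXiv:1701.04488, p. 7:
"`i_X^* i_{X,*} f_*(1) ∈ ℤ · H_X^{n-r}`"; here for an arbitrary `(m+1)`-cycle `γ` of `ℙ^{d+1}` in
place of `i_{X,*} f_*(1)`): for a hypersurface `i : X ≅ V₊(F) ⊆ ℙ^{d+1}_K` over an algebraically
closed field, `m + c = d`, and an `(m+1)`-plane `M = V₊(ℓ₁, …, ℓ_c) ⊄ X` whose hyperplanes do not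
contain `X`, every `(m+1)`-cycle `γ` of `ℙ^{d+1}` has `V₊(F) · γ|_X` rationally equivalent on `X` to
an integer multiple of the iterated section cycle `(i^*V₊(ℓ_c)) · (⋯ ((i^*V₊(ℓ₁)) · [X]))`
(`γ ∼ a [M]` in `Z_{m+1}(ℙ^{d+1})`, Fulton Example 1.9.3; then Cor. 2.4.1).
[cite: Mboro2018, proof of Thm. 1.2 (arXiv:1701.04488, p. 7)] [cite: Fulton1998, Cor. 2.4.1 and Example 1.9.3] -/
theorem exists_isRationallyEquivalent_gysinCycle_zsmul_iterInter [IsAlgClosed K] {m c : ℕ}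
    (hdim : m + c = d) (ℓ : Fin c → MvPolynomial (Fin (d + 1 + 1)) K)
    (hℓ : ∀ k, ℓ k ∈ grading (Fin (d + 1 + 1)) K 1) (hlin : LinearIndependent K ℓ)
    (hav : ∀ k, (formDivisor (ℓ k) (hℓ k) (hlin.ne_zero k)).Avoids (i.left.base (genericPoint ↥X.left)))
    (w : ↥(projectiveSpace (d + 1) K).left)
    (hw : (ProjectiveSpectrum.asHomogeneousIdeal
      (𝒜 := MvPolynomial.homogeneousSubmodule (Fin (d + 1 + 1)) K) w).toIdeal =
        Ideal.span (Set.range ℓ))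
    (hFw : F ∉ ProjectiveSpectrum.asHomogeneousIdeal
      (𝒜 := MvPolynomial.homogeneousSubmodule (Fin (d + 1 + 1)) K) w)
    (γ : AlgebraicCycle (projectiveSpace (d + 1) K).left ℤ)
    (hγ : γ ∈ cyclesOfDim (projectiveSpace (d + 1) K).left (m + 1)) :
    ∃ a : ℤ, IsRationallyEquivalent
      (CartierDivisor.gysinCycle (X := projectiveSpace (d + 1) K) i.left
        (formDivisor F hF hprime.ne_zero) γ)
      (a • CartierDivisor.iterInter c
        (fun k => (formDivisor (ℓ k) (hℓ k) (hlin.ne_zero k)).pullbackAvoiding i.left (hav k))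
        (primeCycle (genericPoint ↥X.left))) m := by
  have hc : c ≤ d + 1 := by omega
  have hmt : d + 1 - c = m + 1 := by omega
  have hhom : ∀ k, (ℓ k).IsHomogeneous 1 := fun k => (MvPolynomial.mem_homogeneousSubmodule 1 _).1 (hℓ k)
  obtain ⟨a, ha⟩ := exists_isRationallyEquivalent_zsmul_primeCycle_of_toIdeal_eq_span (N := d + 1)
    ℓ hlin hhom hc hw γ (by rwa [hmt])
  rw [hmt] at ha
  refine ⟨a, ?_⟩
  set D : CartierDivisor (projectiveSpace (d + 1) K).left := formDivisor F hF hprime.ne_zero with hD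
  have hrat := gysinCycle_formDivisor_mem_ratTrivial i hF hprime hrange (m := m) ha
  have hlinG : CartierDivisor.gysinCycle (X := projectiveSpace (d + 1) K) i.left D (γ - a • primeCycle w) =
      CartierDivisor.gysinCycle (X := projectiveSpace (d + 1) K) i.left D γ -
        a • CartierDivisor.gysinCycle (X := projectiveSpace (d + 1) K) i.left D (primeCycle w) := by
    simp only [CartierDivisor.gysinCycle, CartierDivisor.interCycle_sub,
      CartierDivisor.interCycle_zsmul, ← cycleRestrictClosedHom_apply, map_sub, map_zsmul]
  rw [hlinG, gysinCycle_formDivisor_primeCycle_eq_iterInter i hF hprime hrange c ℓ hℓ hlin hc hav w hw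
    hFw] at hrat
  exact hrat

/-- **`[V₊(F) · γ|_X] = a · (c₁(𝒪_X(1))ᶜ ∩ [X])` in `CH_m(X)`: `i_X^*(CH_{m+1}(ℙ^{d+1})) ⊆ ℤ · H_X^c`**
(Mboro, arXiv:1701.04488, p. 7: "`i_X^* i_{X,*} f_*(1) ∈ ℤ · H_X^{n-r}`"). For a hypersurface
`i : X ≅ V₊(F) ⊆ ℙ^{d+1}_K` (`K` algebraically closed, `F` prime of degree `≥ 1`), `m + c = d`,
and a hyperplane `V₊(ℓ₀) ⊅ X` defining `c₁(𝒪_X(1)) ∩ –` (`ProjSpace.hyperplaneSectionOnIter`), the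
class of the Gysin cycle of any `(m+1)`-cycle `γ` of `ℙ^{d+1}` is an integer multiple of
`c₁(𝒪_X(1))ᶜ ∩ [X]`. [cite: Mboro2018, proof of Thm. 1.2 (arXiv:1701.04488, p. 7)] [cite: Fulton1998, Cor. 2.4.1, Example 1.9.3 and Example 2.5.1] -/
theorem exists_mk_gysinCycle_eq_zsmul_hyperplaneSectionOnIter [IsAlgClosed K] {m c : ℕ}
    (hdim : m + c = d) {ℓ₀ : MvPolynomial (Fin (d + 1 + 1)) K}
    (hℓ₀ : ℓ₀ ∈ grading (Fin (d + 1 + 1)) K 1) (hℓ₀0 : ℓ₀ ≠ 0)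
    (hX₀ : (formDivisor ℓ₀ hℓ₀ hℓ₀0).Avoids (i.left.base (genericPoint ↥X.left)))
    (γ : AlgebraicCycle (projectiveSpace (d + 1) K).left ℤ)
    (hγ : γ ∈ cyclesOfDim (projectiveSpace (d + 1) K).left (m + 1)) :
    ∃ a : ℤ, ChowGroup.mk X.left m
        ⟨CartierDivisor.gysinCycle (X := projectiveSpace (d + 1) K) i.left
            (formDivisor F hF hprime.ne_zero) γ,
          CartierDivisor.gysinCycle_mem_cyclesOfDim (X := projectiveSpace (d + 1) K) i.left _ hγ⟩ =
      a • hyperplaneSectionOnIter i hℓ₀ hℓ₀0 hX₀ m c (ChowGroup.mk X.left (m + c)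
        ⟨primeCycle (genericPoint ↥X.left), primeCycle_mem_cyclesOfDim
          (by rw [height_genericPoint i hF hprime hrange]; exact_mod_cast hdim.symm)⟩) := by
  have he := pos_of_mem_grading_of_prime hF hprime
  have hFhom : F.IsHomogeneous e := (MvPolynomial.mem_homogeneousSubmodule e F).1 hF
  -- an `(m+1)`-plane not contained in `X`
  obtain ⟨ℓ, hlin, hhom, hFℓ⟩ := exists_linearForms_not_mem_idealSpan (N := d + 1) he hFhom
    hprime.ne_zero (c := c) (by omega)
  have hℓ : ∀ k, ℓ k ∈ grading (Fin (d + 1 + 1)) K 1 :=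
    fun k => (MvPolynomial.mem_homogeneousSubmodule 1 _).2 (hhom k)
  have hav : ∀ k, (formDivisor (ℓ k) (hℓ k) (hlin.ne_zero k)).Avoids
      (i.left.base (genericPoint ↥X.left)) := by
    intro k
    refine formDivisor_avoids_base_genericPoint i hF hprime hrange (hℓ k) (hlin.ne_zero k) fun h => hFℓ ?_
    exact Ideal.span_mono (Set.singleton_subset_iff.2 (Set.mem_range_self k)) h
  obtain ⟨w, hw, -, -⟩ := exists_point_of_linearIndependent ℓ hlin hhom (by omega)
  have hFw : F ∉ ProjectiveSpectrum.asHomogeneousIdeal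
      (𝒜 := MvPolynomial.homogeneousSubmodule (Fin (d + 1 + 1)) K) w := by
    intro h
    apply hFℓ
    rw [← hw]
    exact h
  obtain ⟨a, ha⟩ := exists_isRationallyEquivalent_gysinCycle_zsmul_iterInter i hF hprime hrange hdim
    ℓ hℓ hlin hav w hw hFw γ hγ
  refine ⟨a, ?_⟩
  rw [← mk_iterInter_primeCycle_eq_hyperplaneSectionOnIter i hF hprime hrange hdim ℓ hℓ
    (fun k => hlin.ne_zero k) hav hℓ₀ hℓ₀0 hX₀, ← map_zsmul]
  exact ChowGroup.mk_eq_mk_iff.mpr ha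

end Hypersurface

end Literature.AlgebraicGeometry.Motives

end
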